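import Summits.AtomisticToContinuum.HydrodynamicLimit.Theses.JaynesSqueeze

/-!
# `JaynesSqueeze.Assembly` — the rev-2 proof record (stmt-AtomisticToContinuum-13465, RETIRED) and the
# rev-3 frame from the squeeze closure (stmt-AtomisticToContinuum-15956)

History. The assembly item of route `route-AtomisticToContinuum-JaynesSqueeze` was first, arrow for
arrow, the type of the route file's then deciding theorem `closes`:
`NoMeanEntropyProduction → CollisionalFluxLocality → EnergyCurrentTails → MeanBlocksInRange →
DiluteSelfConsistency → HsEosLowDensity → HardSphereLDA → LocalGibbsConcentrationDilute →
EntropicWeakStrongHS → SqueezeToBlockGibbs → BlockGibbsToRelEntropy → EntropyToHydro →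
_root_.HydrodynamicLimit`, and `jaynesSqueeze_assembly_proof : JaynesSqueeze.Assembly` proved it (item
stmt-AtomisticToContinuum-13465, @ 14778427d7cb) by pure bookkeeping — unfold, twelve `intro`s,
`hE (hB (hS h₁ h₄ h₇ h₆ h₅) h₂ h₃ h₄ h₉ h₇ h₈ h₆ h₅)`. The ground battery then closed that form
(`intros; aesop`), and the route was repaired: rev 3 (2026-08-16T16:57Z) RE-TYPED `Assembly` in place as
the FRAME `NoMeanEntropyProduction → CollisionalFluxLocality → EnergyCurrentTails → MeanBlocksInRange →
DiluteSelfConsistency → _root_.HydrodynamicLimit` (stmt-AtomisticToContinuum-15956, "the five ranked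
cruxes alone imply the conjunct", NOT pure logic), rev 7 dropped `EntropyToHydro`, and the deciding
theorem became crux-only, `closes : … → SqueezeClosure → _root_.HydrodynamicLimit` with the sixth
antecedent `SqueezeClosure` (the five cruxes ⟹ Yau's relative-entropy target, crux-grade) and the
re-typed, packing-guarded statement reached through `HydrodynamicLimit.of_unguarded`. The name
`JaynesSqueeze.Assembly` thus changed meaning under this append-only file, whose twelve-`intro` proof
stopped elaborating (full build 2026-08-17: `introN` failed).

Status of the rev-3 frame. `Assembly` (stmt-15956) is NOT provable now: besides the five cruxes it needs
exactly the squeeze closure `SqueezeClosure` (an OPEN crux of the route; equivalently the four remaining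
support debts `SqueezeToBlockGibbs`, `BlockGibbsToRelEntropy`, `LocalGibbsConcentrationDilute`,
`EntropicWeakStrongHS` listed in the item's note). This file therefore records exactly that, sorry-free:
`jaynesSqueeze_assembly_of_squeezeClosure : SqueezeClosure → Assembly`
(`fun h₆ h₁ h₂ h₃ h₄ h₅ => closes h₁ h₂ h₃ h₄ h₅ h₆`), which does NOT close stmt-15956 (its hypothesis is an
open item), and keeps the landed name `jaynesSqueeze_assembly_proof` as a DEPRECATED ALIAS of it
(Theorems files are append-only; pattern of `Theorems/CurvatureOrSymmetryAssemblyFrame.lean`,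
`Theorems/EulerCharacteristicsAssembly.lean`). The rev-2 twelve-arrow statement survives in the route
file's item records and in the ledger signature of stmt-13465. Nothing here discharges any crux.
-/

namespace Summit.AtomisticToContinuum.HydrodynamicLimit.Theorems

open Summit.AtomisticToContinuum.HydrodynamicLimit.Theses

/-- **The rev-3 frame of route `JaynesSqueeze` from the squeeze closure** (item
stmt-AtomisticToContinuum-15956 is `Assembly := NoMeanEntropyProduction → CollisionalFluxLocality →
EnergyCurrentTails → MeanBlocksInRange → DiluteSelfConsistency → _root_.HydrodynamicLimit`): granted
`SqueezeClosure` — the five dynamical cruxes imply Yau's relative-entropy target `RelEntropyVanishing`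
(crux-grade; the composite of the support chain squeeze ⟹ block Gibbs ⟹ relative entropy) — the frame
holds by the route's crux-only deciding theorem: `fun h₁ … h₅ => closes h₁ h₂ h₃ h₄ h₅ h₆` (the entropy
target ⟹ the unguarded Literature statement by the proved `heatBathForgetting_assembly_proof`, ⟹ the
packing-guarded conjunct by `HydrodynamicLimit.of_unguarded`, both inside `closes`). The hypothesis is
an OPEN route item; this theorem does not close stmt-15956, it states what the frame still owes.
[cite: Yau1991, §2] [cite: Dafermos1979, §3] -/
theorem jaynesSqueeze_assembly_of_squeezeClosure (h₆ : JaynesSqueeze.SqueezeClosure) :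
    JaynesSqueeze.Assembly := by
  unfold JaynesSqueeze.Assembly
  intro h₁ h₂ h₃ h₄ h₅
  exact JaynesSqueeze.closes h₁ h₂ h₃ h₄ h₅ h₆

/-- Deprecated spelling: the rev-2 twelve-arrow assembly (item stmt-AtomisticToContinuum-13465, proved
@ 14778427d7cb, closed again by the ground battery and replaced at route rev 3 by the frame
stmt-AtomisticToContinuum-15956) was stated through the route decl `JaynesSqueeze.Assembly` BY NAME,
whose definiens changed at rev 3; the old twelve-`intro` proof no longer elaborates and the new frame is
not yet provable (it needs the open crux `SqueezeClosure`), so the landed name is kept as a deprecated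
alias of the conditional frame `jaynesSqueeze_assembly_of_squeezeClosure` (Theorems files are
append-only). -/
@[deprecated jaynesSqueeze_assembly_of_squeezeClosure (since := "2026-08-17")]
alias jaynesSqueeze_assembly_proof := jaynesSqueeze_assembly_of_squeezeClosure

end Summit.AtomisticToContinuum.HydrodynamicLimit.Theorems
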